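import Summits.CriticalPhenomena.SAWScalingLimit.Theorems.SAWDevelopingMapHexTransferPortDictionarySums
import HarnessLib

/-!
# Port dictionary, part 5: the face product is the Glazman–Manolescu weight

Support file for item stmt-CriticalPhenomena-6966 (`SAWCompassLattice.PortDictionary`), stub
`stub_portDictionary` of line `Sketch` of crux stmt-CriticalPhenomena-14221 (`HexTransfer`);
continues parts 1–4.

For a Yang–Baxter walk `γ` of `Δ` (tree structure `YBWalk`): `facesOf γ.mids = γ.facesVisited`,
`(passages γ.mids f).map kindOf = γ.kindsIn f`, the passages of a face are non-degenerate and never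
repeat a terminal pair (mid-edges are crossed once), hence (`Psi_eq_weight`, by part 2's
`W_eq_localWeight`) `Psi C ∅ γ.mids = w_{π/2}(γ)` under the compass equations.  Conversely
(`exists_ybWalk`), an admissible port sequence with `Psi ≠ 0` IS the list of mid-edges of a
Yang–Baxter walk: two consecutive arcs in one face would be two passages sharing a terminal, and
the two straight arcs of a face would be the crossing pairing — both have no disjoint routes
(parts 1–2), forcing `Psi = 0`.
-/

namespace Summit.CriticalPhenomena.SAWScalingLimit.Cruxes.HexTransfer.Sketch.PortDict

open Literature.Probability.RandomPlanarGeometry.SAW.YangBaxter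

/-! ## Passages of arcs -/

/-- `cyc ∘ sideIdx f` recovers the side. -/
theorem cyc_sideIdx_side (f : Face) (sd : Side) : cyc (sideIdx f (f.side sd)) = sd :=
  Face.side_injective f (side_cyc_sideIdx ⟨sd, rfl⟩)

/-- `sideIdx f` is injective on the sides of `f`. -/
theorem sideIdx_inj {f : Face} {x y : MidEdge} (hx : ∃ sd, f.side sd = x) (hy : ∃ sd, f.side sd = y)
    (h : sideIdx f x = sideIdx f y) : x = y := by
  rw [← side_cyc_sideIdx hx, ← side_cyc_sideIdx hy, h]

/-- The terminal pair of an arc read through `kindOf` is the kind of the arc. -/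
theorem map_kindOf_termPair (f : Face) (p : MidEdge × MidEdge) :
    (termPair f p).map kindOf = (if arcFace p = some f then arcKindOf p else none) := by
  unfold termPair
  split_ifs with h
  · obtain ⟨sd, t, -, hs, ht, hk⟩ := exists_sides_of_arcFace h
    rw [Option.map_some, hk, kindOf, ← hs, ← ht, cyc_sideIdx_side, cyc_sideIdx_side]
  · rfl

/-- A terminal pair of an arc in `f` comes from two distinct sides of `f`. -/
theorem termPair_eq_some {f : Face} {p : MidEdge × MidEdge} {t : Fin 4 × Fin 4} (h : termPair f p = some t) :
    arcFace p = some f ∧ t = (sideIdx f p.1, sideIdx f p.2) ∧ p.1 ≠ p.2 ∧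
      (∃ sd, f.side sd = p.1) ∧ ∃ sd, f.side sd = p.2 := by
  unfold termPair at h
  split_ifs at h with hf
  · obtain ⟨hne, h1, h2⟩ := (MidEdge.commonFace_eq_some_iff p.1 p.2 f).1 hf
    exact ⟨hf, (Option.some_injective _ h).symm, hne, h1, h2⟩

namespace Compass

variable (C : Compass) {Δ : Set Face} {a b : MidEdge}

/-- Visited faces are the faces of the port sequence. -/
theorem facesOf_mids (γ : YBWalk Δ a b) : facesOf γ.mids = γ.facesVisited := rfl

/-- Kinds in a face are the kinds of its passages. -/
theorem map_kindOf_passages (γ : YBWalk Δ a b) (f : Face) : (passages γ.mids f).map kindOf = γ.kindsIn f := by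
  rw [passages, List.map_filterMap]
  simp only [map_kindOf_termPair]
  rfl

/-- Passages of a walk are non-degenerate. -/
theorem passages_nondegenerate (γ : YBWalk Δ a b) (f : Face) : ∀ t ∈ passages γ.mids f, t.1 ≠ t.2 := by
  intro t ht
  obtain ⟨p, -, hp⟩ := List.mem_filterMap.1 ht
  obtain ⟨-, rfl, hne, h1, h2⟩ := termPair_eq_some hp
  exact fun h => hne (sideIdx_inj h1 h2 h)

/-- Two entries of a list, in order, form a sublist. -/
theorem pair_sublist {α : Type*} {l : List α} {i j : ℕ} (hi : i < l.length) (hj : j < l.length) (hij : i < j) :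
    [l[i], l[j]].Sublist l := by
  have := List.map_getElem_sublist (l := l) (is := [⟨i, hi⟩, ⟨j, hj⟩]) (by simp [hij])
  simpa using this

/-- Passages of a walk never repeat a terminal pair, in either orientation (each mid-edge is
crossed once). -/
theorem passages_pairwise (γ : YBWalk Δ a b) (f : Face) :
    (passages γ.mids f).Pairwise fun p q => ¬(q = p ∨ q = (p.2, p.1)) := by
  rw [passages, List.pairwise_filterMap, List.pairwise_iff_getElem]
  intro i j hi hj hij p hp q hq
  obtain ⟨-, rfl, -, hi1, hi2⟩ := termPair_eq_some hp
  obtain ⟨-, rfl, -, hj1, hj2⟩ := termPair_eq_some hq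
  have hlen := γ.length_arcs
  have ei : (arcsOf γ.mids)[i] = (γ.mids[i]'(by rw [hlen] at hi; omega), γ.mids[i + 1]'(by rw [hlen] at hi; omega)) :=
    γ.getElem_arcs hi
  have ej : (arcsOf γ.mids)[j] = (γ.mids[j]'(by rw [hlen] at hj; omega), γ.mids[j + 1]'(by rw [hlen] at hj; omega)) :=
    γ.getElem_arcs hj
  rw [ei] at hi1 hi2 ⊢
  rw [ej] at hj1 hj2 ⊢
  have hnd := γ.nodup
  rintro (h | h) <;> simp only [Prod.mk.injEq] at h
  · have e1 := sideIdx_inj hj1 hi1 h.1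
    have := (hnd.getElem_inj_iff).1 e1
    omega
  · have e1 := sideIdx_inj hj1 hi2 h.1
    have e2 := sideIdx_inj hj2 hi1 h.2
    have := (hnd.getElem_inj_iff).1 e1
    have := (hnd.getElem_inj_iff).1 e2
    omega

/-- **The face product of a Yang–Baxter walk is its Glazman–Manolescu weight** (at `θ = π/2`,
under the compass equations). -/
theorem Psi_eq_weight (hU : C.z ^ 2 * Tadj C.α C.β C.s = weightU1 (Real.pi / 2))
    (hV : C.z ^ 2 * Topp C.α C.β C.s = weightV (Real.pi / 2))
    (hW : C.z ^ 4 * Dpair C.α C.β C.s = weightW1 (Real.pi / 2)) (γ : YBWalk Δ a b) :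
    Psi C (fun _ => []) γ.mids = γ.weight fun _ => Real.pi / 2 := by
  rw [Psi, YBWalk.weight, facesOf_mids]
  refine Finset.prod_congr rfl fun f _ => ?_
  rw [W_eq_localWeight hU hV hW _ (passages_nondegenerate γ f) (passages_pairwise γ f),
    map_kindOf_passages γ f]

/-! ## From an admissible port sequence with `Psi ≠ 0` to a Yang–Baxter walk -/

variable {C}

/-- A face of the port sequence with `Psi ≠ 0` has a non-vanishing route sum. -/
theorem W_passages_ne_zero {U : Face → List Node} {ms : List MidEdge} (h : Psi C U ms ≠ 0) {f : Face}
    {p : MidEdge × MidEdge} (hp : p ∈ arcsOf ms) (hpf : arcFace p = some f) :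
    W C.α C.β C.s C.z (passages ms f) (U f) ≠ 0 :=
  Finset.prod_ne_zero_iff.1 h f (List.mem_toFinset.2 (List.mem_filterMap.2 ⟨p, hp, hpf⟩))

/-- Two arcs of the port sequence, in order and in the same face `f`, give two passages of `f` in
order. -/
theorem sublist_passages {ms : List MidEdge} {f : Face} {p q : MidEdge × MidEdge}
    (hpq : [p, q].Sublist (arcsOf ms)) (hp : arcFace p = some f) (hq : arcFace q = some f) :
    [(sideIdx f p.1, sideIdx f p.2), (sideIdx f q.1, sideIdx f q.2)].Sublist (passages ms f) := by
  have := hpq.filterMap (termPair f)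
  simpa [passages, termPair, hp, hq] using this

/-- Consecutive arcs lie in different faces when `Psi ≠ 0` (two passages sharing a terminal have no
disjoint routes). -/
theorem isChain_of_Psi_ne_zero {U : Face → List Node} {ms : List MidEdge} (h : Psi C U ms ≠ 0)
    (harcs : ∀ p ∈ arcsOf ms, ∃ f ∈ Δ, arcFace p = some f) :
    (arcsOf ms).IsChain fun p q => arcFace p ≠ arcFace q := by
  rw [List.isChain_iff_getElem]
  intro i hi heq
  obtain ⟨f, -, hf⟩ := harcs _ (List.getElem_mem (Nat.lt_of_succ_lt hi))
  have hf' : arcFace (arcsOf ms)[i + 1] = some f := by rw [← heq, hf]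
  have hsub := sublist_passages (pair_sublist (Nat.lt_of_succ_lt hi) hi (Nat.lt_succ_self i)) hf hf'
  obtain ⟨r₁, hr₁, r₂, hr₂, hav⟩ := exists_pair_of_W_ne_zero (W_passages_ne_zero h
    (List.getElem_mem (Nat.lt_of_succ_lt hi)) hf) hsub
  -- the two arcs share the mid-edge `ms[i+1]`, hence the two passages share its terminal
  have hshared : SharedB (sideIdx f (arcsOf ms)[i].1, sideIdx f (arcsOf ms)[i].2)
      (sideIdx f (arcsOf ms)[i + 1].1, sideIdx f (arcsOf ms)[i + 1].2) = true := by
    have e : (arcsOf ms)[i + 1].1 = (arcsOf ms)[i].2 := by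
      simp [arcsOf, List.getElem_zip, List.getElem_tail]
    simp [SharedB, e]
  rw [not_avoid_of_shared hshared hr₁ hr₂] at hav
  exact Bool.false_ne_true hav

/-- The two straight arcs of a face do not both occur when `Psi ≠ 0` (planarity of the gadget). -/
theorem noncross_of_Psi_ne_zero {U : Face → List Node} {ms : List MidEdge} (h : Psi C U ms ≠ 0) (f : Face) :
    ((f.side .W, f.side .E) ∈ arcsOf ms ∨ (f.side .E, f.side .W) ∈ arcsOf ms) →
      ¬((f.side .S, f.side .N) ∈ arcsOf ms ∨ (f.side .N, f.side .S) ∈ arcsOf ms) := by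
  intro hWE hSN
  have hinj := Face.side_injective f
  have harc : ∀ sd t : Side, sd ≠ t → arcFace (f.side sd, f.side t) = some f := fun sd t hst =>
    (MidEdge.commonFace_eq_some_iff _ _ f).2 ⟨fun h => hst (hinj h), ⟨sd, rfl⟩, ⟨t, rfl⟩⟩
  -- one of the two arcs comes first
  obtain ⟨p, q, hp, hsub⟩ : ∃ p q : MidEdge × MidEdge,
      ((p = (f.side .W, f.side .E) ∨ p = (f.side .E, f.side .W)) ∧
        (q = (f.side .S, f.side .N) ∨ q = (f.side .N, f.side .S)) ∨
       (q = (f.side .W, f.side .E) ∨ q = (f.side .E, f.side .W)) ∧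
        (p = (f.side .S, f.side .N) ∨ p = (f.side .N, f.side .S))) ∧
      [p, q].Sublist (arcsOf ms) := by
    obtain ⟨x, hx, hxm⟩ : ∃ x, (x = (f.side .W, f.side .E) ∨ x = (f.side .E, f.side .W)) ∧ x ∈ arcsOf ms := by
      rcases hWE with h | h
      · exact ⟨_, Or.inl rfl, h⟩
      · exact ⟨_, Or.inr rfl, h⟩
    obtain ⟨w, hw, hwm⟩ : ∃ w, (w = (f.side .S, f.side .N) ∨ w = (f.side .N, f.side .S)) ∧ w ∈ arcsOf ms := by
      rcases hSN with h | h
      · exact ⟨_, Or.inl rfl, h⟩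
      · exact ⟨_, Or.inr rfl, h⟩
    obtain ⟨i, hi, rfl⟩ := List.getElem_of_mem hxm
    obtain ⟨j, hj, rfl⟩ := List.getElem_of_mem hwm
    have hij : i ≠ j := by
      rintro rfl
      rcases hx with hx | hx <;> rcases hw with hw | hw <;>
        · have e := hx.symm.trans hw
          simp only [Prod.mk.injEq] at e
          exact absurd (hinj e.1) (by decide)
    rcases Nat.lt_or_gt_of_ne hij with hlt | hlt
    · exact ⟨_, _, Or.inl ⟨hx, hw⟩, pair_sublist hi hj hlt⟩
    · exact ⟨_, _, Or.inr ⟨hx, hw⟩, pair_sublist hj hi hlt⟩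
  -- their terminal pairs form the crossing pairing
  have hpf : arcFace p = some f := by
    rcases hp with ⟨hp, -⟩ | ⟨-, hp⟩ <;> rcases hp with rfl | rfl <;> exact harc _ _ (by decide)
  have hqf : arcFace q = some f := by
    rcases hp with ⟨-, hq⟩ | ⟨hq, -⟩ <;> rcases hq with rfl | rfl <;> exact harc _ _ (by decide)
  have hmem : p ∈ arcsOf ms := hsub.subset (by simp)
  obtain ⟨r₁, hr₁, r₂, hr₂, hav⟩ :=
    exists_pair_of_W_ne_zero (W_passages_ne_zero h hmem hpf) (sublist_passages hsub hpf hqf)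
  have hcross : (sideIdx f p.2 = sideIdx f p.1 + 2 ∧
      (sideIdx f q.1 = sideIdx f p.1 + 1 ∧ sideIdx f q.2 = sideIdx f p.1 + 3 ∨
        sideIdx f q.1 = sideIdx f p.1 + 3 ∧ sideIdx f q.2 = sideIdx f p.1 + 1)) := by
    have h0 : sideIdx f (f.side .W) = 0 := sideIdx_side_cyc f 0
    have h1 : sideIdx f (f.side .N) = 1 := sideIdx_side_cyc f 1
    have h2 : sideIdx f (f.side .E) = 2 := sideIdx_side_cyc f 2
    have h3 : sideIdx f (f.side .S) = 3 := sideIdx_side_cyc f 3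
    rcases hp with ⟨hp, hq⟩ | ⟨hq, hp⟩ <;> rcases hp with rfl | rfl <;> rcases hq with rfl | rfl <;>
      simp only [h0, h1, h2, h3] <;> decide
  have := filter_avoid_eq_nil_of_cross hcross hr₁
  rw [List.filter_eq_nil_iff] at this
  exact absurd hav (by simpa using this r₂ hr₂)

variable (C) in
/-- **An admissible port sequence with `Psi ≠ 0` is a Yang–Baxter walk.** -/
theorem exists_ybWalk {ms : List MidEdge} (hnd : (a :: ms).Nodup) (hlast : (a :: ms).getLast? = some b)
    (harcs : ∀ p ∈ arcsOf (a :: ms), ∃ f ∈ Δ, arcFace p = some f)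
    (h : Psi C (fun _ => []) (a :: ms) ≠ 0) : ∃ γ : YBWalk Δ a b, γ.mids = a :: ms :=
  ⟨{ mids := a :: ms
     head_eq := rfl
     getLast_eq := hlast
     nodup := hnd
     arc_mem := harcs
     isChain := isChain_of_Psi_ne_zero h harcs
     noncross := noncross_of_Psi_ne_zero h }, rfl⟩

end Compass

end Summit.CriticalPhenomena.SAWScalingLimit.Cruxes.HexTransfer.Sketch.PortDict
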